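/-
Copyright: cell pub-balaban-gaps (YM BLITZ Y1, track G1), seat g1-p2 GEN 9 (unit `pub-balaban-gaps-g1-p2`).  Row (D4) NODE O,
JUNCTION J-3 (multi-level) — GAUGE COVARIANCE of the model covariant multi-level operator and the TRANSFER of the Green-function END
(84) from a gauge-transformed field `U^g` in the (3.37) window to `U` itself ([B9] Cor. 3.6 p. 408: the results at `U′ = U^u = e^{iηA}`
transfer to `U`; p. 398: gauge invariance).  A site gauge `g` (fibre matrices with two-sided inverses `g⁻`, independent of the
configuration) acts on bond fields by `U_μ(y) ↦ g(y)U_μ(y)g⁻(y + e_μ)`, on sections by the site-diagonal `fibD g`, and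
`Δ_W(U^g) + L^{2k}·covAvgOp(U^g) = (fibD g)(Δ_W(U) + L^{2k}·covAvgOp(U))(fibD g⁻)` provided the contours `Γ x` are CONNECTED paths from a
block base point `β x` (one per averaging block) to `x`; then the Green function at `U` is `(fibD g⁻)·G(U^g)·(fibD g)`, a block walk
expansion by 90's `BlockWalkExpansion.conj` at cost `r(g)r(g⁻)`.  HONEST FRAMING: `U`, `g` hypothesis SHAPES (the gauge is NOT produced
from (3.35)–(3.36) here); VALUE letters transfer, the derivative-letter conjunct of 84 is not transferred (flat differences do not commute
with a site gauge); (D4) NOT discharged (instance 0∕1); NOT BetaPertH, NOT continuum, NOT Clay.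
-/
import Summits.QuantumFields.BalabanUV.Gaps.D4WalkBlockCovariantGreenMultiLevel
import Summits.QuantumFields.BalabanUV.Gaps.D4WalkBlockConjugate
import Summits.QuantumFields.BalabanUV.Gaps.D4WalkBlockGaugeAlgebra

/-!
# `Gaps.D4WalkBlockCovariantGaugeMultiLevel` — gauge covariance of the covariant multi-level operator with contour averaging, and
# the gauge transfer of its Green-function block walk expansion (cell pub-balaban-gaps, seat g1-p2 gen 9)

HONEST DEPENDENCY (cell pub-balaban, verbatim): continuum YM on T⁴ ⇐ BetaPertH ∧ nine spine estimates (0/9 proved);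
BetaPertH ⇐ (D1) ∧ (D4) ∧ CAP+tail.

* (site-fibre algebra and `covLap_gauge`: `D4WalkBlockGaugeAlgebra`; connected paths `IsPath`, telescoping and the CANONICAL contours
  `levContour` ∕ `levBase` discharging the contour hypotheses: `D4WalkBlockContourPath`.)
* §1 **`covAvgOp_gauge`** (the contour averaging on [4]'s
  nested family is covariant when `Γ x` runs from `β x` to `x` with `β` constant on averaging blocks), **`covGreen_gauge`** (the Green
  function conjugates); §2 the END **`blockWalkExpansion_covariantGreen_gauge_multiLevelTorus`**: 84's hypotheses for the
  gauge-transformed pair `(U^g, (U^g)⁻)` ⟹ the Green function AT `U` is a block walk expansion, constants × `r(g)r(g⁻)`.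
WHAT IT IS NOT.  The gauge `g` from (3.35)–(3.36) (print's axial ∕ Landau-type constructions, [5]); the derivative letters at `U`;
(D4) instance 0∕1; words of row (D4) UNCHANGED.

References: T. Bałaban, Comm. Math. Phys. **99** (1985) 389–434 [B9], p. 398, (3.35)–(3.37) p. 396, Cor. 3.5 p. 407, Cor. 3.6 p. 408;
Comm. Math. Phys. **96** (1984) [4], (2.13)–(2.14) p. 225; Comm. Math. Phys. **116** (1988) [II], (1.11) p. 5, p. 15.
-/

noncomputable section

namespace Summit.QuantumFields.BalabanUV.Gaps.D4WalkBlockCovariantGaugeMultiLevel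

open Metric NormedSpace
open scoped Matrix
open Literature.MathematicalPhysics.QuantumFieldTheory.Balaban1983to89
open Literature.MathematicalPhysics.QuantumFieldTheory.Balaban1983to89.B4Reflection242 (boxDom blk)
open Literature.MathematicalPhysics.QuantumFieldTheory.Balaban1983to89.B9SectDWalk (DomBy)
open Literature.MathematicalPhysics.QuantumFieldTheory.Balaban1983to89.B9Thm34Ext (toB6)
open Literature.MathematicalPhysics.QuantumFieldTheory.Balaban1983to89.B9Thm37GlueTorus (torusGeom tdist1)
open Literature.MathematicalPhysics.QuantumFieldTheory.Balaban1983to89.TreeLengthTorus (TPt)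
open Literature.MathematicalPhysics.QuantumFieldTheory.Balaban1983to89.B5TorusCover (UT)
open Literature.MathematicalPhysics.QuantumFieldTheory.Balaban1983to89.B11SectG (RowSum)
open Literature.MathematicalPhysics.QuantumFieldTheory.Balaban1983to89.B6MultiLevelBoxOperator (N0 levC)
open Literature.MathematicalPhysics.QuantumFieldTheory.Balaban1983to89.B6MultiLevelTorusOperator (TDomains gmlT tshift unitVec)
open Literature.MathematicalPhysics.QuantumFieldTheory.Balaban1983to89.B6Ineq243TwoLevelBox (aNext)
open Summit.QuantumFields.BalabanUV.Gaps.D4WalkBlock (blockNorm BlockWalkExpansion)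
open Summit.QuantumFields.BalabanUV.Gaps.D4WalkBlockMultiLevelGeometry (cubeML)
open Summit.QuantumFields.BalabanUV.Gaps.D4WalkBlockShiftAlgebra (fibD relab Sfw Sbw fibD_add fibD_local)
open Summit.QuantumFields.BalabanUV.Gaps.D4WalkBlockShiftStep (covLap)
open Summit.QuantumFields.BalabanUV.Gaps.D4WalkBlockShiftWeighted (covDopW covBW covAlphaW)
open Summit.QuantumFields.BalabanUV.Gaps.D4WalkBlockWeightedLettersMultiLevel (levW)
open Summit.QuantumFields.BalabanUV.Gaps.D4WalkBlockCovariantAveragingMultiLevel (covAvgOp)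
open Summit.QuantumFields.BalabanUV.Gaps.D4WalkBlockCovariantContourMultiLevel (contourT contourTi)
open Summit.QuantumFields.BalabanUV.Gaps.D4WalkBlockCovariantGreenMultiLevel (blockWalkExpansion_covariantGreen_multiLevelTorus)
open Summit.QuantumFields.BalabanUV.Gaps.D4WalkBlockGaugeAlgebra
open Summit.QuantumFields.BalabanUV.Gaps.D4WalkBlockContourPath (IsPath prod_map_gauge prod_map_gauge_reverse)

variable {d : ℕ}

/-! ## §1. Gauge covariance of the contour averaging and of the Green function -/

section MultiLevel

variable {ℓ Mh k R : ℕ} {P : Fin (d + 1) → ℕ} (D : TDomains d ℓ Mh k P R) (a : ℕ → ℝ)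
variable {F : Type} [Fintype F] [DecidableEq F] {E : Type*} [NormedAddCommGroup E] [NormedSpace ℂ E]
variable (Γ : ↥(boxDom (N0 ℓ Mh k P)) → List (↥(boxDom (N0 ℓ Mh k P)) × Fin (d + 1)))
variable (β : ↥(boxDom (N0 ℓ Mh k P)) → ↥(boxDom (N0 ℓ Mh k P)))
variable (U Ui : Fin (d + 1) → E → ↥(boxDom (N0 ℓ Mh k P)) → Matrix F F ℂ) {g gi : ↥(boxDom (N0 ℓ Mh k P)) → Matrix F F ℂ}

omit [Fintype F] [DecidableEq F] in
/-- Scalar fibre blocks: `Matrix.of (a b ↦ c·M a b) = c • M`. -/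
theorem of_const_mul_eq_smul (c : ℂ) (M : Matrix F F ℂ) : (Matrix.of fun a b => c * M a b) = c • M := by
  ext a b; simp

omit [NormedAddCommGroup E] [NormedSpace ℂ E] in
/-- **GAUGE COVARIANCE OF THE CONTOUR AVERAGING** on [4]'s nested family: if every contour `Γ x` is a connected path from the base
point `β x` to `x` and `β` is constant on each averaging block, then with `U^g_b = g(b₋)U_bg⁻(b₊)`, `(U^g)⁻_b = g(b₊)U⁻_bg⁻(b₋)` the block
transporters telescope and `covAvgOp(T(U^g), T̃(U^g)) = fibD g · covAvgOp(T(U), T̃(U)) · fibD g⁻`.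
[cite: Balaban1985BackgroundPropagators, p.398, (3.8) p.392, (3.78) p.406; Balaban1984PropagatorsII, (2.13)–(2.14) p.225] -/
theorem covAvgOp_gauge (hg : ∀ x, g x * gi x = 1) (hgi : ∀ x, gi x * g x = 1)
    (hpath : ∀ x, IsPath (fun ν => tshift (N0 ℓ Mh k P) (unitVec ν)) (Γ x) (β x) x)
    (hβ : ∀ x x' : ↥(boxDom (N0 ℓ Mh k P)), blk ((ℓ + 1) ^ D.lev x.1) x'.1 = blk ((ℓ + 1) ^ D.lev x.1) x.1 → β x' = β x) (u : E) :
    covAvgOp D a (contourT Γ fun u b => g b.1 * U b.2 u b.1 * gi ((tshift (N0 ℓ Mh k P) (unitVec b.2)) b.1))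
        (contourTi Γ fun u b => g ((tshift (N0 ℓ Mh k P) (unitVec b.2)) b.1) * Ui b.2 u b.1 * gi b.1) u =
      fibD _ F g * covAvgOp D a (contourT Γ fun u b => U b.2 u b.1) (contourTi Γ fun u b => Ui b.2 u b.1) u * fibD _ F gi := by
  ext p q
  rw [fibD_mul_mul_fibD_apply]
  unfold covAvgOp
  simp only [Matrix.of_apply]
  by_cases hc : blk ((ℓ + 1) ^ D.lev p.1.1) q.1.1 = blk ((ℓ + 1) ^ D.lev p.1.1) p.1.1
  · simp only [if_pos hc]
    rw [of_const_mul_eq_smul, Matrix.mul_smul, Matrix.smul_mul, Matrix.smul_apply, smul_eq_mul]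
    congr 1
    -- the transporters telescope
    have hT : contourT Γ (fun u b => g b.1 * U b.2 u b.1 * gi ((tshift (N0 ℓ Mh k P) (unitVec b.2)) b.1)) u q.1 =
        g (β q.1) * contourT Γ (fun u b => U b.2 u b.1) u q.1 * gi q.1 := by
      unfold contourT
      exact prod_map_gauge (fun ν => tshift (N0 ℓ Mh k P) (unitVec ν)) hgi hg (fun bd => U bd.2 u bd.1) (hpath q.1)
    have hTi : contourTi Γ (fun u b => g ((tshift (N0 ℓ Mh k P) (unitVec b.2)) b.1) * Ui b.2 u b.1 * gi b.1) u p.1 =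
        g p.1 * contourTi Γ (fun u b => Ui b.2 u b.1) u p.1 * gi (β p.1) := by
      unfold contourTi
      exact prod_map_gauge_reverse (fun ν => tshift (N0 ℓ Mh k P) (unitVec ν)) hgi hg (fun bd => Ui bd.2 u bd.1) (hpath p.1)
    rw [hT, hTi, hβ p.1 q.1 hc]
    simp only [← Matrix.mul_assoc]
    rw [Matrix.mul_assoc (g p.1 * contourTi Γ (fun u b => Ui b.2 u b.1) u p.1) (gi (β p.1)) (g (β p.1)), hgi, Matrix.mul_one]
  · simp only [if_neg hc]
    have e : (Matrix.of fun (_ : F) (_ : F) => (0 : ℂ)) = 0 := by ext a b; simp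
    rw [e, Matrix.mul_zero, Matrix.zero_mul, Matrix.zero_apply]

omit [NormedAddCommGroup E] [NormedSpace ℂ E] in
/-- **THE GREEN FUNCTION CONJUGATES**: under the hypotheses of `covLap_gauge` ∕ `covAvgOp_gauge`,
`(Δ_W(U^g) + c·covAvgOp(U^g))⁻¹ = fibD g · (Δ_W(U) + c·covAvgOp(U))⁻¹ · fibD g⁻`. [cite: Balaban1985BackgroundPropagators, p.398, Cor. 3.6 p.408] -/
theorem covGreen_gauge (hg : ∀ x, g x * gi x = 1) (hgi : ∀ x, gi x * g x = 1)
    (hpath : ∀ x, IsPath (fun ν => tshift (N0 ℓ Mh k P) (unitVec ν)) (Γ x) (β x) x)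
    (hβ : ∀ x x' : ↥(boxDom (N0 ℓ Mh k P)), blk ((ℓ + 1) ^ D.lev x.1) x'.1 = blk ((ℓ + 1) ^ D.lev x.1) x.1 → β x' = β x)
    (η : ℝ) (cc : ℂ) (u : E) :
    (covLap ↥(boxDom (N0 ℓ Mh k P)) F (fun ν => tshift (N0 ℓ Mh k P) (unitVec ν)) η
        (fun ν u x => g x * U ν u x * gi ((tshift (N0 ℓ Mh k P) (unitVec ν)) x) - 1)
        (fun ν u x => g ((tshift (N0 ℓ Mh k P) (unitVec ν)) ((tshift (N0 ℓ Mh k P) (unitVec ν)).symm x)) *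
          Ui ν u ((tshift (N0 ℓ Mh k P) (unitVec ν)).symm x) * gi ((tshift (N0 ℓ Mh k P) (unitVec ν)).symm x) - 1) u +
      cc • covAvgOp D a (contourT Γ fun u b => g b.1 * U b.2 u b.1 * gi ((tshift (N0 ℓ Mh k P) (unitVec b.2)) b.1))
        (contourTi Γ fun u b => g ((tshift (N0 ℓ Mh k P) (unitVec b.2)) b.1) * Ui b.2 u b.1 * gi b.1) u)⁻¹ =
      fibD _ F g * (covLap ↥(boxDom (N0 ℓ Mh k P)) F (fun ν => tshift (N0 ℓ Mh k P) (unitVec ν)) η (fun ν u x => U ν u x - 1)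
        (fun ν u x => Ui ν u ((tshift (N0 ℓ Mh k P) (unitVec ν)).symm x) - 1) u +
        cc • covAvgOp D a (contourT Γ fun u b => U b.2 u b.1) (contourTi Γ fun u b => Ui b.2 u b.1) u)⁻¹ * fibD _ F gi := by
  rw [covLap_gauge (fun ν => tshift (N0 ℓ Mh k P) (unitVec ν)) η U Ui hg u, covAvgOp_gauge D a Γ β U Ui hg hgi hpath hβ u,
    ← Matrix.smul_mul, ← Matrix.mul_smul, ← Matrix.add_mul, ← Matrix.mul_add]
  exact conj_inv_eq _ _ _ (fibD_mul_fibD_eq_one hg) (fibD_mul_fibD_eq_one hgi)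

end MultiLevel

/-! ## §2. The END: 84's block walk expansion transferred from `U^g` to `U` -/

section Green

variable {dd N' : ℕ} {E : Type*} [NormedAddCommGroup E] [NormedSpace ℂ E]

/-- **[B9] COR. 3.5 ∕ 3.6 — THE GREEN FUNCTION AT `U` FROM THE (3.37) WINDOW AT A GAUGE TRANSFORM `U^g`.**  For a bond field `U` with
two-sided inverses `U⁻` (holomorphic entries), a configuration-independent site gauge `g` with two-sided inverse `g⁻` and row sums
`≤ r′`, `≤ r`, and contours `Γ x` running from block base points `β x` to `x` (`β` constant on averaging blocks): if the GAUGE-TRANSFORMED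
pair `(U^g, (U^g)⁻)` satisfies 84's (3.37) windows, then the Green function `(Δ_W(U) + L^{2k}·covAvgOp(U,Γ))⁻¹` AT `U` is a block walk
expansion with Cor. 3.5's walks — 84 at `U^g`, `covGreen_gauge`, and 90's `BlockWalkExpansion.conj` with `fibD g⁻`, `fibD g` (constant
`× rr′`).  VALUE letters only. [cite: Balaban1985BackgroundPropagators, Cor. 3.5 p.407, Cor. 3.6 p.408, p.398, (3.37) p.396; Balaban1984PropagatorsII, (2.13)–(2.14) p.225; Balaban1988RG2Cluster, (1.11) p.5, p.15] -/
theorem blockWalkExpansion_covariantGreen_gauge_multiLevelTorus (d ℓ : ℕ) (hℓ : 1 ≤ ℓ) (aminus aplus a2minus a2plus : ℝ)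
    (ha : 0 < aminus) (ha2 : 0 < a2minus) :
    ∃ δ₁ C M₀ : ℝ, ∃ N₀ : ℕ, 0 < δ₁ ∧ 0 < C ∧ 0 < M₀ ∧ 0 < N₀ ∧
      ∀ (k Mh R : ℕ), 3 ≤ Mh → M₀ ≤ ((ℓ : ℝ) + 1) * Mh → 2 * (ℓ + 1) ≤ R → N₀ + 1 ≤ R * ((ℓ + 1) * Mh) →
      ∀ (P : Fin (d + 1) → ℕ) (hP : ∀ μ, 1 ≤ P μ) (hP4 : ∀ μ, 4 ≤ P μ) (D : TDomains d ℓ Mh k P R) (a c : ℕ → ℝ),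
        (∀ i, 1 ≤ i → aminus ≤ a i ∧ a i ≤ aplus) → (∀ i, 1 ≤ i → a2minus ≤ c i ∧ c i ≤ a2plus) →
        (∀ i, 1 ≤ i → a (i + 1) = aNext ℓ (a i) (c i)) →
      ∀ (Kc : Fin (d + 1) → ℕ) [∀ i, NeZero (Kc i)], (∀ i, N0 ℓ Mh k P i = (ℓ + 1) ^ k * Kc i) →
      ∀ (F : Type) [Fintype F] [DecidableEq F] (c₀ : B13.Consts) (Xs : Finset (UT Kc)) (Rb : ℝ)
        (U Ui : Fin (d + 1) → E → ↥(boxDom (N0 ℓ Mh k P)) → Matrix F F ℂ)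
        (Γ : ↥(boxDom (N0 ℓ Mh k P)) → List (↥(boxDom (N0 ℓ Mh k P)) × Fin (d + 1)))
        (β : ↥(boxDom (N0 ℓ Mh k P)) → ↥(boxDom (N0 ℓ Mh k P))) (g gi : ↥(boxDom (N0 ℓ Mh k P)) → Matrix F F ℂ)
        (r r' α₀ α₁ ε μ cμ : ℝ),
      (∀ x, g x * gi x = 1) → (∀ x, gi x * g x = 1) → 0 ≤ r → 0 ≤ r' → (∀ x a', ∑ b, ‖gi x a' b‖ ≤ r) →
      (∀ x a', ∑ b, ‖g x a' b‖ ≤ r') →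
      (∀ x, IsPath (fun ν => tshift (N0 ℓ Mh k P) (unitVec ν)) (Γ x) (β x) x) →
      (∀ x x' : ↥(boxDom (N0 ℓ Mh k P)), blk ((ℓ + 1) ^ D.lev x.1) x'.1 = blk ((ℓ + 1) ^ D.lev x.1) x.1 → β x' = β x) →
      (∀ ν y a' b, DifferentiableOn ℂ (fun u => U ν u y a' b) (ball (0 : E) Rb)) →
      (∀ ν y a' b, DifferentiableOn ℂ (fun u => Ui ν u y a' b) (ball (0 : E) Rb)) →
      (∀ ν u y, U ν u y * Ui ν u y = 1) → 0 ≤ α₀ → 0 ≤ α₁ →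
      (∀ ν, ∀ u ∈ ball (0 : E) Rb, ∀ y a', ∑ b, ‖(g y * U ν u y * gi ((tshift (N0 ℓ Mh k P) (unitVec ν)) y) - 1) a' b‖ ≤ α₀ * ((((ℓ : ℝ) + 1) ^ D.lev y.1))⁻¹) →
      (∀ ν, ∀ u ∈ ball (0 : E) Rb, ∀ y a', ∑ b, ‖(g ((tshift (N0 ℓ Mh k P) (unitVec ν)) y) * Ui ν u y * gi y - 1) a' b‖ ≤ α₀ * ((((ℓ : ℝ) + 1) ^ D.lev y.1))⁻¹) →
      (∀ ν, ∀ u ∈ ball (0 : E) Rb, ∀ x a', ∑ b, ‖(g x * U ν u x * gi ((tshift (N0 ℓ Mh k P) (unitVec ν)) x) -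
        g ((tshift (N0 ℓ Mh k P) (unitVec ν)).symm x) * U ν u ((tshift (N0 ℓ Mh k P) (unitVec ν)).symm x) *
          gi ((tshift (N0 ℓ Mh k P) (unitVec ν)) ((tshift (N0 ℓ Mh k P) (unitVec ν)).symm x))) a' b‖ ≤
        α₁ * ((((ℓ : ℝ) + 1) ^ D.lev x.1))⁻¹ ^ 2) →
      (∀ x, (Γ x).length ≤ (d + 1) * (ℓ + 1) ^ D.lev x.1) →
      (∀ x, ∀ b ∈ Γ x, blk ((ℓ + 1) ^ D.lev x.1) b.1.1 = blk ((ℓ + 1) ^ D.lev x.1) x.1) →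
      0 ≤ μ → 2 * μ ≤ ε → 2 * μ ≤ δ₁ - ε - μ → 0 ≤ cμ →
      RowSum (toB6 (torusGeom Kc 0 0 0) 0 True) μ cμ →
      cμ * (cμ * 1 * (1 * ((0 + ∑ j : Unit ⊕ (Fin (d + 1) ⊕ Fin (d + 1)),
        covAlphaW (((ℓ : ℝ) + 1) * α₀) (((d : ℝ) + 1) * (α₁ + (((ℓ : ℝ) + 1) * α₀) ^ 2) +
          aplus * (Real.exp (2 * ((d : ℝ) + 1) * α₀) - 1)) j * covBW δ₁ ((ℓ : ℝ) + 1) j) * C)) * cμ) * cμ < 1 →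
      ∃ (W : Type) (T : W → (TPt dd N' → ℂ) → E → Matrix (↥(boxDom (N0 ℓ Mh k P)) × F) (↥(boxDom (N0 ℓ Mh k P)) × F) ℂ)
        (SX' : Set W) (A' : W → ℝ) (D' : W → UT Kc → UT Kc → ℝ),
        BlockWalkExpansion c₀ (fun q : ↥(boxDom (N0 ℓ Mh k P)) × F => cubeML ℓ k Kc q.1.1)
          (fun q : ↥(boxDom (N0 ℓ Mh k P)) × F => cubeML ℓ k Kc q.1.1)
          (fun (_ : TPt dd N' → ℂ) u =>
            (covLap ↥(boxDom (N0 ℓ Mh k P)) F (fun ν => tshift (N0 ℓ Mh k P) (unitVec ν)) ((((ℓ : ℝ) + 1) ^ k)⁻¹)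
                (fun ν u x => U ν u x - 1) (fun ν u x => Ui ν u ((tshift (N0 ℓ Mh k P) (unitVec ν)).symm x) - 1) u +
              (((ℓ : ℂ) + 1) ^ (2 * k) : ℂ) • covAvgOp D a (contourT Γ fun u b => U b.2 u b.1) (contourTi Γ fun u b => Ui b.2 u b.1) u)⁻¹)
          Xs Rb (ε - 2 * μ) (δ₁ - ε - μ - 2 * μ)
          (r * r' * (cμ * C * (1 * (1 - cμ * (cμ * 1 * (1 * ((0 + ∑ j : Unit ⊕ (Fin (d + 1) ⊕ Fin (d + 1)),
            covAlphaW (((ℓ : ℝ) + 1) * α₀) (((d : ℝ) + 1) * (α₁ + (((ℓ : ℝ) + 1) * α₀) ^ 2) +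
              aplus * (Real.exp (2 * ((d : ℝ) + 1) * α₀) - 1)) j * covBW δ₁ ((ℓ : ℝ) + 1) j) * C)) * cμ) * cμ)⁻¹) * cμ))
          T SX' A' D' (δ₁ - 2 * μ) ∧
        ∀ ω, DomBy (toB6 (torusGeom Kc 0 0 0) 0 True) (D' ω) := by
  obtain ⟨δ₁, C, M₀, N₀, hδ₁, hC, hM₀, hN₀, hmain⟩ :=
    blockWalkExpansion_covariantGreen_multiLevelTorus (dd := dd) (N' := N') (E := E) d ℓ hℓ aminus aplus a2minus a2plus ha ha2
  refine ⟨δ₁, C, M₀, N₀, hδ₁, hC, hM₀, hN₀, ?_⟩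
  intro k Mh R hMh hM hR hRM P hP hP4 D a c haw hcw hac Kc _ hKc F _ _ c₀ Xs Rb U Ui Γ β g gi r r' α₀ α₁ ε μ cμ hg hgi hr0 hr0' hr hr'
    hpath hβ hUh hUih hinv hα₀ hα₁ hU0 hUi0 hU1 hlen hblkΓ hμ hμε hμκ hcμ hrow hq
  -- the gauged pair: holomorphic entries, two-sided inverse
  have hc : ∀ (M : Matrix F F ℂ) a' b, DifferentiableOn ℂ (fun _ : E => M a' b) (ball (0 : E) Rb) := fun M a' b =>
    differentiableOn_const _
  have hUgh : ∀ ν y a' b, DifferentiableOn ℂ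
      (fun u => (fun ν u y => g y * U ν u y * gi ((tshift (N0 ℓ Mh k P) (unitVec ν)) y)) ν u y a' b) (ball (0 : E) Rb) :=
    fun ν y a' b => D4WalkProduct.differentiableOn_mul_entry (M₁ := fun u => g y * U ν u y)
      (D4WalkProduct.differentiableOn_mul_entry (hc (g y)) (hUh ν y)) (hc _) a' b
  have hUigh : ∀ ν y a' b, DifferentiableOn ℂ
      (fun u => (fun ν u y => g ((tshift (N0 ℓ Mh k P) (unitVec ν)) y) * Ui ν u y * gi y) ν u y a' b) (ball (0 : E) Rb) :=
    fun ν y a' b => D4WalkProduct.differentiableOn_mul_entry (M₁ := fun u => g _ * Ui ν u y)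
      (D4WalkProduct.differentiableOn_mul_entry (hc (g _)) (hUih ν y)) (hc _) a' b
  have hinvg : ∀ ν u y, (fun ν u y => g y * U ν u y * gi ((tshift (N0 ℓ Mh k P) (unitVec ν)) y)) ν u y *
      (fun ν u y => g ((tshift (N0 ℓ Mh k P) (unitVec ν)) y) * Ui ν u y * gi y) ν u y = 1 := by
    intro ν u y
    show g y * U ν u y * gi ((tshift (N0 ℓ Mh k P) (unitVec ν)) y) *
      (g ((tshift (N0 ℓ Mh k P) (unitVec ν)) y) * Ui ν u y * gi y) = 1
    calc g y * U ν u y * gi ((tshift (N0 ℓ Mh k P) (unitVec ν)) y) * (g ((tshift (N0 ℓ Mh k P) (unitVec ν)) y) * Ui ν u y * gi y)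
        = g y * U ν u y * (gi ((tshift (N0 ℓ Mh k P) (unitVec ν)) y) * g ((tshift (N0 ℓ Mh k P) (unitVec ν)) y)) * Ui ν u y * gi y := by
          simp only [Matrix.mul_assoc]
      _ = 1 := by rw [hgi, Matrix.mul_one, Matrix.mul_assoc (g y), hinv, Matrix.mul_one, hg]
  obtain ⟨W, T, SX', A', D', hE, -, hDom⟩ := hmain k Mh R hMh hM hR hRM P hP hP4 D a c haw hcw hac Kc hKc F c₀ Xs Rb
    (fun ν u y => g y * U ν u y * gi ((tshift (N0 ℓ Mh k P) (unitVec ν)) y))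
    (fun ν u y => g ((tshift (N0 ℓ Mh k P) (unitVec ν)) y) * Ui ν u y * gi y) Γ α₀ α₁ ε μ cμ hUgh hUigh hinvg hα₀ hα₁ hU0
    hUi0 hU1 hlen hblkΓ hμ hμε hμκ hcμ hrow hq
  -- conjugate by fibD g⁻ (left) and fibD g (right): cube-local, row-bounded
  have hloc : ∀ (h : ↥(boxDom (N0 ℓ Mh k P)) → Matrix F F ℂ) (i j : ↥(boxDom (N0 ℓ Mh k P)) × F),
      (fun q : ↥(boxDom (N0 ℓ Mh k P)) × F => cubeML ℓ k Kc q.1.1) i ≠ (fun q : ↥(boxDom (N0 ℓ Mh k P)) × F => cubeML ℓ k Kc q.1.1) j →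
        fibD _ F h i j = 0 := by
    intro h i j hij
    by_contra hne
    exact hij (fibD_local (fun x : ↥(boxDom (N0 ℓ Mh k P)) => cubeML ℓ k Kc x.1) h i j hne)
  have hrow_gi : ∀ i : ↥(boxDom (N0 ℓ Mh k P)) × F, ∑ j, ‖fibD _ F gi i j‖ ≤ r := fun i => by rw [rowSum_fibD]; exact hr i.1 i.2
  have hrow_g : ∀ i : ↥(boxDom (N0 ℓ Mh k P)) × F, ∑ j, ‖fibD _ F g i j‖ ≤ r' := fun i => by rw [rowSum_fibD]; exact hr' i.1 i.2
  have hconj := hE.conj (fibD _ F gi) (fibD _ F g) (hloc gi) (hloc g) hr0 hr0' hrow_gi hrow_g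
  refine ⟨W, _, SX', _, D', hconj.congrK (fun σ u _ _ => ?_), hDom⟩
  -- K_U = fibD g⁻ · K_{U^g} · fibD g
  have key := covGreen_gauge D a Γ β U Ui hg hgi hpath hβ ((((ℓ : ℝ) + 1) ^ k)⁻¹) (((ℓ : ℂ) + 1) ^ (2 * k) : ℂ) u
  rw [key]
  simp only [← Matrix.mul_assoc]
  rw [fibD_mul_fibD_eq_one hgi, Matrix.one_mul, Matrix.mul_assoc, fibD_mul_fibD_eq_one hgi, Matrix.mul_one]

end Green

end Summit.QuantumFields.BalabanUV.Gaps.D4WalkBlockCovariantGaugeMultiLevel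

end
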